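import Summits.PneNP.PneNP.Theorems.ChebyshevTracialDesignLevelDominanceSharp
import HarnessLib

/-!
# Cell pnp-psdrank, route `ChebyshevTracialDesign`: `σ_{2κ'}(c) ≤ σ_{2κ'}(1)` as an eigenvalue statement

Harmonic backbone of the crux `TracialDecayExp20` (stmt-PneNP-19878), eng g8 (corollary of `…LevelDominanceSharp`).
For `n` even, `t = 2c+1` with `2t + 2 ≤ n`, `κ' ≤ c`, `m ≤ c`, with `κ₁` the Gram class function of the tight incidence (`cc = 1`)
and `κ_m` that of the level-`(2m+1)` incidence on the `t`-sets:
  `kernelEigen n t (2κ') κ_m · kernelEigen n t 0 κ₁ ≤ kernelEigen n t (2κ') κ₁ · kernelEigen n t 0 κ_m`   (`kernelEigen_level_ratio_le`),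
i.e. the normalised layer-`2κ'` eigenvalue `λ_{2κ'}(c)/λ₀(c)` of EVERY level relation between `t`-cuts and perfect matchings is at most the
tight one — the TIGHT LEVEL DOMINATES, constant one (prover g6's proportionality `kernelEigen_level_mul_eq` × eng g8's
`bimodeCoeff_sq_mul_le_sharp` × the handshake `λ₀(κ₁)·T(N;2m+1,c−m)² = λ₀(κ_m)·T(N;1,c)²`). The hypothesis `2t + 2 ≤ n` is necessary
(at `t = n/2` the level `c = t` beats the tight one: `(10,5)`: `λ₂/λ₀ = 1/10 > 8/125`, eng MEMO-8 §5).
[cite: Rothvoss2017, §2 (PDF p. 6)] [cite: GodsilMeagher2015, §15.2 (perfect matching scheme)] [cite: BrouwerHaemers2012, Prop. 4.3.2 (PDF p. 83)]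
Stature: support/instrument. WHAT THIS IS NOT: not (L2)/SNT, nothing on psd rank, no P-vs-NP content. No definitions.
Supports crux stmt-PneNP-19878.
-/

set_option linter.dupNamespace false -- `Summit.PneNP.PneNP.…`: summit = sub-problem (D-0017)

noncomputable section

namespace Summit.PneNP.PneNP.Theorems.ChebyshevTracialDesignLevelDominanceRatio

open Finset Literature.Combinatorics.AssociationSchemes Literature.Combinatorics.AssociationSchemes.JohnsonHarmonics
open Literature.Combinatorics.AssociationSchemes.JohnsonSpectrum
open Literature.Barriers.PneNP
open Summit.PneNP.PneNP.Theorems.ChebyshevTracialDesignLevelAttenuation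
open Summit.PneNP.PneNP.Theorems.ChebyshevTracialDesignTightEigenDecay
open Summit.PneNP.PneNP.Theorems.ChebyshevTracialDesignLevelDominanceSharp

variable {n : ℕ}

/-- **The tight level dominates (eigenvalue form, constant one).** For `n` even, `t = 2c+1`, `2t + 2 ≤ n`, `κ' ≤ c`, `m ≤ c`:
`λ_{2κ'}(κ_m) · λ₀(κ₁) ≤ λ_{2κ'}(κ₁) · λ₀(κ_m)`, i.e. `σ_{2κ'}(2m+1)² ≤ σ_{2κ'}(1)²` for the normalised singular values of the level
relations. [cite: Rothvoss2017, §2 (PDF p. 6)] [cite: GodsilMeagher2015, §15.2 (perfect matching scheme)] -/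
theorem kernelEigen_level_ratio_le {c κ' m : ℕ} (hn : Even n) (ht : 2 * (2 * c + 1) + 2 ≤ n) (hκc : κ' ≤ c) (hmc : m ≤ c)
    (κ₁ κm : ℕ → ℝ)
    (hA1 : ∀ U ∈ univ.powersetCard (2 * c + 1), ∀ U' ∈ univ.powersetCard (2 * c + 1),
      ∑ M : PMatch n, (if (U.filter fun x => M.2.partner x ∉ U).card = 1 then (1 : ℝ) else 0) *
        (if (U'.filter fun x => M.2.partner x ∉ U').card = 1 then (1 : ℝ) else 0) = κ₁ (U ∩ U').card)
    (hAm : ∀ U ∈ univ.powersetCard (2 * c + 1), ∀ U' ∈ univ.powersetCard (2 * c + 1),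
      ∑ M : PMatch n, (if (U.filter fun x => M.2.partner x ∉ U).card = 2 * m + 1 then (1 : ℝ) else 0) *
        (if (U'.filter fun x => M.2.partner x ∉ U').card = 2 * m + 1 then (1 : ℝ) else 0) = κm (U ∩ U').card) :
    kernelEigen n (2 * c + 1) (2 * κ') κm * kernelEigen n (2 * c + 1) 0 κ₁ ≤
      kernelEigen n (2 * c + 1) (2 * κ') κ₁ * kernelEigen n (2 * c + 1) 0 κm := by
  classical
  have ht' : 2 * (2 * c + 1) ≤ n := by omega
  have hcN : 2 * c + 2 ≤ n / 2 := by obtain ⟨k, hk⟩ := hn; omega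
  have hprop := kernelEigen_level_mul_eq ht' hκc hmc κ₁ κm hA1 hAm
  have hdom := bimodeCoeff_sq_mul_le_sharp (n / 2) c κ' m hκc hmc hcN
  have h1nn : 0 ≤ kernelEigen n (2 * c + 1) (2 * κ') κ₁ := kernelEigen_tight_even_nonneg hn ht' hκc κ₁ hA1
  -- abbreviations
  set S1 : ℝ := ∑ e' ∈ range (c - κ' + 1), (if e' ≤ c then
      (-1 : ℝ) ^ (κ' - (c - e')) * (κ'.choose (c - e') : ℝ) *
        (((n / 2 - 2 * κ').choose (2 * (c - κ') + 1 - 2 * e' + e') *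
            (2 * (c - κ') + 1 - 2 * e' + e').choose e' * 2 ^ (2 * (c - κ') + 1 - 2 * e') : ℕ) : ℝ)
      else 0) with hS1
  set Sm : ℝ := ∑ e' ∈ range (c - κ' + 1), (if e' ≤ c - m then
      (-1 : ℝ) ^ (κ' - (c - m - e')) * (κ'.choose (c - m - e') : ℝ) *
        (((n / 2 - 2 * κ').choose (2 * (c - κ') + 1 - 2 * e' + e') *
            (2 * (c - κ') + 1 - 2 * e' + e').choose e' * 2 ^ (2 * (c - κ') + 1 - 2 * e') : ℕ) : ℝ)
      else 0) with hSm
  set R0 : ℝ := (((n / 2 - 2 * κ').choose (1 + (c - κ')) * (1 + (c - κ')).choose (c - κ') * 2 ^ 1 : ℕ) : ℝ) with hR0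
  set U0 : ℝ := (((n / 2).choose (1 + c) * (1 + c).choose c * 2 ^ 1 : ℕ) : ℝ) with hU0
  set Um : ℝ := (((n / 2).choose (2 * m + 1 + (c - m)) * (2 * m + 1 + (c - m)).choose (c - m) * 2 ^ (2 * m + 1) : ℕ) : ℝ)
    with hUm
  -- the tight coefficient `S1` is the single surviving term `R0 > 0`
  have hS1R0 : S1 = R0 := by
    rw [hS1, sum_eq_single_of_mem (c - κ') (mem_range.2 (by omega))]
    · rw [if_pos (Nat.sub_le c κ'), show c - (c - κ') = κ' by omega, Nat.sub_self, pow_zero, Nat.choose_self, Nat.cast_one,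
        one_mul, one_mul, show 2 * (c - κ') + 1 - 2 * (c - κ') = 1 by omega, hR0]
    · intro e' he' hne
      have he'c : e' < c - κ' := by have := mem_range.1 he'; omega
      rw [if_pos (by omega), Nat.choose_eq_zero_of_lt (by omega : κ' < c - e')]; simp
  have hR0pos : 0 < R0 := by
    rw [hR0]; push_cast
    have h1 : 0 < (((n / 2 - 2 * κ').choose (1 + (c - κ')) : ℕ) : ℝ) := by exact_mod_cast Nat.choose_pos (by omega)
    have h2 : 0 < (((1 + (c - κ')).choose (c - κ') : ℕ) : ℝ) := by exact_mod_cast Nat.choose_pos (by omega)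
    positivity
  have hUmpos : 0 < Um := by
    rw [hUm]; push_cast
    have h1 : 0 < (((n / 2).choose (2 * m + 1 + (c - m)) : ℕ) : ℝ) := by exact_mod_cast Nat.choose_pos (by omega)
    have h2 : 0 < (((2 * m + 1 + (c - m)).choose (c - m) : ℕ) : ℝ) := by exact_mod_cast Nat.choose_pos (by omega)
    positivity
  -- column and row sums, `λ₀ = d_R d_C`, handshake (as in brick 12)
  have hcolm : ∀ M : PMatch n, ∑ U ∈ univ.powersetCard (2 * c + 1),
      (if (U.filter fun x => M.2.partner x ∉ U).card = 2 * m + 1 then (1 : ℝ) else 0) = Um :=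
    fun M => level_colSum_eq ⟨m, rfl⟩ (by omega) M
  have hcol1 : ∀ M : PMatch n, ∑ U ∈ univ.powersetCard (2 * c + 1),
      (if (U.filter fun x => M.2.partner x ∉ U).card = 1 then (1 : ℝ) else 0) = U0 :=
    fun M => level_colSum_eq ⟨0, rfl⟩ (by omega) M
  obtain ⟨U₁, hU₁⟩ : ∃ U : Finset (Fin n), U ∈ univ.powersetCard (2 * c + 1) := by
    have : (univ.powersetCard (2 * c + 1) : Finset (Finset (Fin n))).Nonempty := by
      apply powersetCard_nonempty.2; rw [card_univ, Fintype.card_fin]; omega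
    exact this
  have hU₁t : U₁.card = 2 * c + 1 := (mem_powersetCard.1 hU₁).2
  have hrowm := fun U hU => level_rowSum_eq (t := 2 * c + 1) (r := 2 * m + 1) κm hAm (U := U) hU
  have hrow1 := fun U hU => level_rowSum_eq (t := 2 * c + 1) (r := 1) κ₁ hA1 (U := U) hU
  have hl0m := kernelEigen_zero_eq_rowSum_mul_colSum _ κm hAm hcolm hU₁t (hrowm U₁ hU₁)
  have hl01 := kernelEigen_zero_eq_rowSum_mul_colSum _ κ₁ hA1 hcol1 hU₁t (hrow1 U₁ hU₁)
  have hhm := choose_mul_rowSum_eq_card_mul_colSum _ hcolm hrowm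
  have hh1 := choose_mul_rowSum_eq_card_mul_colSum _ hcol1 hrow1
  have hCnt : 0 < (n.choose (2 * c + 1) : ℝ) := by exact_mod_cast Nat.choose_pos (by omega)
  -- `λ_m · U0² ≤ λ₁ · Um²`
  have step1 : kernelEigen n (2 * c + 1) (2 * κ') κm * U0 ^ 2 * S1 ^ 2 ≤
      kernelEigen n (2 * c + 1) (2 * κ') κ₁ * Um ^ 2 * S1 ^ 2 := by
    calc kernelEigen n (2 * c + 1) (2 * κ') κm * U0 ^ 2 * S1 ^ 2
        = (kernelEigen n (2 * c + 1) (2 * κ') κm * S1 ^ 2) * U0 ^ 2 := by ring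
      _ = kernelEigen n (2 * c + 1) (2 * κ') κ₁ * (Sm ^ 2 * U0 ^ 2) := by rw [hprop]; ring
      _ ≤ kernelEigen n (2 * c + 1) (2 * κ') κ₁ * (R0 ^ 2 * Um ^ 2) := mul_le_mul_of_nonneg_left hdom h1nn
      _ = _ := by rw [← hS1R0]; ring
  have hS1pos : 0 < S1 ^ 2 := by rw [hS1R0]; positivity
  have step1' : kernelEigen n (2 * c + 1) (2 * κ') κm * U0 ^ 2 ≤ kernelEigen n (2 * c + 1) (2 * κ') κ₁ * Um ^ 2 :=
    le_of_mul_le_mul_right step1 hS1pos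
  -- `λ₀(κ₁) · Um² = λ₀(κ_m) · U0²`
  have hswap : kernelEigen n (2 * c + 1) 0 κ₁ * Um ^ 2 = kernelEigen n (2 * c + 1) 0 κm * U0 ^ 2 := by
    have e1 : kernelEigen n (2 * c + 1) 0 κ₁ * Um ^ 2 * (n.choose (2 * c + 1) : ℝ) =
        (Fintype.card (PMatch n) : ℝ) * U0 ^ 2 * Um ^ 2 := by
      rw [hl01]
      calc κ₁ (2 * c + 1) * U0 * Um ^ 2 * (n.choose (2 * c + 1) : ℝ)
          = ((n.choose (2 * c + 1) : ℝ) * κ₁ (2 * c + 1)) * U0 * Um ^ 2 := by ring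
        _ = _ := by rw [hh1]; ring
    have e2 : kernelEigen n (2 * c + 1) 0 κm * U0 ^ 2 * (n.choose (2 * c + 1) : ℝ) =
        (Fintype.card (PMatch n) : ℝ) * U0 ^ 2 * Um ^ 2 := by
      rw [hl0m]
      calc κm (2 * c + 1) * Um * U0 ^ 2 * (n.choose (2 * c + 1) : ℝ)
          = ((n.choose (2 * c + 1) : ℝ) * κm (2 * c + 1)) * Um * U0 ^ 2 := by ring
        _ = _ := by rw [hhm]; ring
    exact mul_right_cancel₀ hCnt.ne' (e1.trans e2.symm)
  have hκm_nn : 0 ≤ κm (2 * c + 1) := by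
    rw [← hrowm U₁ hU₁]
    exact sum_nonneg fun M _ => by split_ifs <;> norm_num
  have hl0m_nn : 0 ≤ kernelEigen n (2 * c + 1) 0 κm := by
    rw [hl0m]; exact mul_nonneg hκm_nn hUmpos.le
  -- assemble, cancelling `Um² > 0`
  have key : kernelEigen n (2 * c + 1) (2 * κ') κm * kernelEigen n (2 * c + 1) 0 κ₁ * Um ^ 2 ≤
      kernelEigen n (2 * c + 1) (2 * κ') κ₁ * kernelEigen n (2 * c + 1) 0 κm * Um ^ 2 := by
    calc kernelEigen n (2 * c + 1) (2 * κ') κm * kernelEigen n (2 * c + 1) 0 κ₁ * Um ^ 2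
        = kernelEigen n (2 * c + 1) (2 * κ') κm * (kernelEigen n (2 * c + 1) 0 κ₁ * Um ^ 2) := by ring
      _ = (kernelEigen n (2 * c + 1) (2 * κ') κm * U0 ^ 2) * kernelEigen n (2 * c + 1) 0 κm := by rw [hswap]; ring
      _ ≤ (kernelEigen n (2 * c + 1) (2 * κ') κ₁ * Um ^ 2) * kernelEigen n (2 * c + 1) 0 κm :=
          mul_le_mul_of_nonneg_right step1' hl0m_nn
      _ = _ := by ring
  exact le_of_mul_le_mul_right key (by positivity)

end Summit.PneNP.PneNP.Theorems.ChebyshevTracialDesignLevelDominanceRatio
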